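import Mathlib
import Literature.Analysis.UnboundedOperators.UnitaryRepSpectralMeasure
import HarnessLib

/-!
# Enflo 2023, v2 eq. (27) (p.13, Case II): the claimed bound `‖ℓ'(T)y − (1+δ)y‖ < (εθ)²` is false in an explicit window

Source under adjudication: Per H. Enflo, *On the invariant subspace problem in Hilbert spaces*, arXiv:2305.15442 (v1
2023, v2 2024), bib key `Enflo2023` — a CLAIMED proof of the invariant subspace problem for operators on a separable
Hilbert space.  This file is part of the kernel-tight typing of the manuscript by the b2b-enflo repair cell
(formaliser 1, Part A: v2 eq. (1)–(27), the set-up, the constructions `V_y`, `ℓ'`, `[ ]x₀`, Lemma 1 and Case I/II of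
the main step).  It records what FOLLOWS (proved implications from the manuscript's displayed hypotheses) and, where a
step does not follow, the typed inference together with its refutation.  NOTHING here asserts that the manuscript's
main theorem holds; no declaration concludes the invariant subspace problem for an arbitrary operator.  Value
(BLOCK-2b): theorems / refutations of typed inferences about a text — not progress on the problem.

STATEMENT-LEVEL REFUTATION OF (27) IN A WINDOW  (Enflo, arXiv:2305.15442v2, p.13, eq. (27); Case II of §"The
proof", pp.12–13).  (The cell's GAP.md §F1 item (2), made kernel-tight.)

Setting of (27): ‖x₀‖ = 1, y = V_{n-1} is εθ-minimal ("⟨y, x₀ − y⟩ = ε·θ", eq. (6) with C‖a‖² = εθ, cf. (20)–(21)),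
T = u₁(T₂) with ‖T‖ ≤ 10⁻²⁰ (p.8, l.-3: "‖u₁(T)‖_op ≤ 10⁻²⁰"), Case II at j = 1: |⟨Ty, x₀−y⟩| ≤ (εθ)⁴,
δ = εθ/10, and ℓ' = Σ a_j T^j the minimal-norm functional moving y into the (ε − δθ/10)-ball … the paper claims
(27): ‖ℓ'(T)(y) − (1+δ)y‖ < (εθ)².

We show: for ANY coefficient data (a₀, a₁, tail t = Σ_{j≥2} a_j T^j y) satisfying only
  * the norm budget ‖ℓ'‖² = |a₀|² + Σ_{j≥1}|a_j|² ≤ (1+δ)²  (ℓ' is norm-minimal and (1+δ)y is feasible, eq. (10)),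
    encoded as |a₀|² + A² ≤ (1+δ)², |a₁| ≤ A, ‖t‖ ≤ A·10⁻⁴⁰ (from ‖T^j y‖ ≤ 10^{-20 j}),
  * the KKT / Lagrange identities of a minimal vector (eq. (5) = `Literature.Analysis.OperatorTheory.Enflo2023.IsMinimal.kkt`/`eq5` in
    MinimalNorm.lean), in coordinates j = 0, 1:  ⟨y, R⟩ = C·a₀,  ⟨Ty, R⟩ = C·a₁,  R := x₀ − ℓ'(T)y,
and for y, Ty in the WINDOW
    10⁻³⁵ ≤ εθ ≤ 10⁻²³,  0.3 ≤ ‖x₀ − y‖ ≤ 0.7,  κ₁ := |⟨y,Ty⟩| ≥ 10⁻²¹,  τ₁ := dist(Ty, ℂy) ≥ 10⁻²¹,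
the move is at least (εθ)²:   ‖ℓ'(T)y − (1+δ)y‖ ≥ (εθ)²  — i.e. (27) is FALSE there (indeed the move is ≥ 10⁻⁴³,
see `scalar_core`).  The window is compatible with everything the paper assumes before (27) (εθ is only required
to be small; κ₁, τ₁ of size ‖T‖·‖y‖ ≈ 10⁻²⁰ are the generic case; Case II restricts only ⟨Ty, x₀ − y⟩).
Hence the inference "(25),(26) ⇒ (27)" does not follow: the first-order coefficient a₁ forced by the Lagrange
condition is ≈ 0.1·κ₁ ≥ 10⁻²², and it moves y by ≥ |a₁|τ₁ − ‖t‖ ≥ 10⁻⁴³ ≫ (εθ)² ≤ 10⁻⁴⁶ orthogonally to y.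

Conventions: Mathlib's ⟪u, v⟫_ℂ is conjugate-linear in u, so the paper's ⟨u, v⟩ is ⟪v, u⟫_ℂ here; all the
hypotheses below are stated with Mathlib's inner product (moduli are unaffected).  No new axioms.
-/

open scoped InnerProductSpace
open Literature.Analysis.UnboundedOperators (inner_self_eq_coe_norm_sq)

noncomputable section

namespace Literature.Analysis.OperatorTheory.Enflo2023

namespace CaseII

/-- The real-arithmetic core of the window refutation of (27).  Variables: `et = εθ`, `Y = ‖y‖²`, `yn = ‖y‖`,
`b = |β| = |1+δ−a₀|`, `A = (Σ_{j≥1}|a_j|²)^{1/2}`, `n1 = |a₁|`, `σ = ‖Ty‖`, `κ = |⟨y,Ty⟩|`, `τ = dist(Ty, ℂy)`, `nt = ‖tail‖`,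
`p = |⟨y,R⟩|`, `m = |⟨Ty,R⟩|`, `n0 = |a₀|`, `d = ‖ℓ'(T)y − (1+δ)y‖`. [cite: Enflo2023, v2 p.13, eq. (27)] -/
theorem scalar_core (et Y yn b A n1 σ κ τ nt p m n0 d : ℝ)
    (het1 : 1 / 10 ^ 35 ≤ et) (het2 : et ≤ 1 / 10 ^ 23)
    (hY1 : 1 / 2 ≤ Y) (hY2 : Y ≤ 0.91) (hyn : 0 ≤ yn) (hyn2 : yn ^ 2 = Y)
    (hb : 0 ≤ b) (hn1 : 0 ≤ n1) (hA : n1 ≤ A)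
    (h1 : A ^ 2 ≤ 2 * (1 + et / 10) * b)
    (hσ0 : 0 ≤ σ) (hσ : σ ≤ 1 / 10 ^ 20)
    (hκ : 1 / 10 ^ 21 ≤ κ) (hκ2 : κ ≤ yn * σ)
    (hτ : 1 / 10 ^ 21 ≤ τ)
    (hnt0 : 0 ≤ nt) (hnt : nt ≤ A / 10 ^ 40)
    (h2 : b * yn ≤ d + n1 * σ + nt)
    (h3 : p ≤ et * (1 - Y / 10) + b * Y + n1 * κ + yn * nt)
    (h4 : (et / 10 - b) * κ - et ^ 4 - n1 * σ ^ 2 - σ * nt ≤ m)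
    (h5 : m * n0 = p * n1)
    (h6 : 1 + et / 10 - b ≤ n0)
    (h7 : n1 * τ - nt ≤ d)
    (hd : d < et ^ 2) : False := by
  have het0 : 0 < et := lt_of_lt_of_le (by norm_num) het1
  have hetsq : et ^ 2 ≤ et / 10 ^ 23 := by
    have h := mul_le_mul_of_nonneg_left het2 het0.le
    rw [sq]; linarith only [h]
  have hA0 : 0 ≤ A := le_trans hn1 hA
  have hyn2' : yn * yn = Y := by rw [← sq, hyn2]
  -- ‖y‖ ∈ [0.7071, 0.954]
  have hyn1 : 0.7071 ≤ yn := by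
    by_contra h
    push Not at h
    have := mul_lt_mul'' h h hyn hyn
    linarith only [this, hyn2', hY1]
  have hyn3 : yn ≤ 0.954 := by
    by_contra h
    push Not at h
    have := mul_lt_mul'' h h (by norm_num) (by norm_num)
    linarith only [this, hyn2', hY2]
  have hκ0 : 0 ≤ κ := le_trans (by norm_num) hκ
  have hτ0 : 0 ≤ τ := le_trans (by norm_num) hτ
  have hκ3 : κ ≤ 0.954 * (1 / 10 ^ 20) := by
    have := mul_le_mul hyn3 hσ hσ0 (by norm_num)
    linarith only [hκ2, this]
  -- K1 := 1e-20 + 1e-40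
  have hK : n1 * σ + nt ≤ A * (1 / 10 ^ 20 + 1 / 10 ^ 40) := by
    have : n1 * σ ≤ A * (1 / 10 ^ 20) := mul_le_mul hA hσ hσ0 hA0
    linarith only [this, hnt]
  have hb1 : b * 0.7071 ≤ et ^ 2 + A * (1 / 10 ^ 20 + 1 / 10 ^ 40) := by
    have : b * 0.7071 ≤ b * yn := mul_le_mul_of_nonneg_left hyn1 hb
    linarith only [this, h2, hK, hd.le]
  have hA1 : A ^ 2 ≤ 2.01 * b := by
    have : 2 * (1 + et / 10) * b ≤ 2.01 * b :=
      mul_le_mul_of_nonneg_right (by linarith only [het2]) hb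
    linarith only [h1, this]
  have hA2 : A ^ 2 ≤ 2.85 * et ^ 2 + 2.85 * (1 / 10 ^ 20 + 1 / 10 ^ 40) * A := by
    have e := mul_le_mul_of_nonneg_left hb1 (by norm_num : (0:ℝ) ≤ 2.01)
    have f : 0 ≤ A * (1 / 10 ^ 20 + 1 / 10 ^ 40) := by positivity
    linarith only [hA1, e, sq_nonneg et, f]
  have hA3 : A ≤ 2.85 * (1 / 10 ^ 20 + 1 / 10 ^ 40) + 1.69 * et := by
    by_contra hc
    push Not at hc
    have hM0 : 0 < 2.85 * (1 / 10 ^ 20 + 1 / 10 ^ 40) + 1.69 * et := by positivity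
    have h1' := mul_lt_mul_of_pos_right hc (lt_trans hM0 hc)
    have h2' : 1.69 * et * (1.69 * et) < 1.69 * et * A :=
      mul_lt_mul_of_pos_left (by linarith only [hc]) (by positivity)
    have e3 : A ^ 2 = A * A := sq A
    have e4 : et ^ 2 = et * et := sq et
    linarith only [h1', h2', hA2, e3, e4, sq_nonneg et]
  have hA4 : A ≤ 2.87 / 10 ^ 20 := by linarith only [hA3, het2]
  have hb2 : b ≤ 4.1 / 10 ^ 5 * et := by
    have e : A * (1 / 10 ^ 20 + 1 / 10 ^ 40) ≤ 2.87 / 10 ^ 20 * (1 / 10 ^ 20 + 1 / 10 ^ 40) :=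
      mul_le_mul_of_nonneg_right hA4 (by norm_num)
    linarith only [hb1, hetsq, e, het1]
  have hp : p ≤ 0.951 * et := by
    have e1 : et * (1 / 2) ≤ et * Y := mul_le_mul_of_nonneg_left hY1 het0.le
    have e2 : b * Y ≤ 4.1 / 10 ^ 5 * et * 0.91 := mul_le_mul hb2 hY2 (by linarith only [hY1]) (by positivity)
    have e3 : n1 * κ ≤ 2.87 / 10 ^ 20 * (0.954 * (1 / 10 ^ 20)) :=
      mul_le_mul (le_trans hA hA4) hκ3 hκ0 (by norm_num)
    have e4 : yn * nt ≤ 0.954 * (2.87 / 10 ^ 20 / 10 ^ 40) :=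
      mul_le_mul hyn3 (le_trans hnt (div_le_div_of_nonneg_right hA4 (by positivity))) hnt0 (by norm_num)
    have e5 : et * (1 - Y / 10) = et - et * Y / 10 := by ring
    linarith only [h3, e1, e2, e3, e4, e5, het1]
  have hm : 0.0996 * et * κ ≤ m := by
    have e1 : (0.1 - 4.1 / 10 ^ 5) * et * κ ≤ (et / 10 - b) * κ := by
      apply mul_le_mul_of_nonneg_right _ hκ0; linarith only [hb2]
    have e2 : et ^ 4 ≤ et * κ / 10 ^ 48 := by
      have h3 := pow_le_pow_left₀ het0.le het2 3
      have h3' := mul_le_mul_of_nonneg_right h3 het0.le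
      have h5 := mul_le_mul_of_nonneg_left hκ het0.le
      have e : et ^ 4 = et ^ 3 * et := by ring
      rw [e]
      have : (1 / 10 ^ 23 : ℝ) ^ 3 * et = et * (1 / 10 ^ 21) / 10 ^ 48 := by ring
      linarith only [h3', h5, this]
    have e3 : n1 * σ ^ 2 ≤ 2.87 / 10 ^ 20 * (1 / 10 ^ 20) ^ 2 :=
      mul_le_mul (le_trans hA hA4) (pow_le_pow_left₀ hσ0 hσ 2) (by positivity) (by norm_num)
    have e4 : σ * nt ≤ 1 / 10 ^ 20 * (2.87 / 10 ^ 20 / 10 ^ 40) :=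
      mul_le_mul hσ (le_trans hnt (div_le_div_of_nonneg_right hA4 (by positivity))) hnt0 (by norm_num)
    have e5 : 1 / 10 ^ 35 * (1 / 10 ^ 21) ≤ et * κ := mul_le_mul het1 hκ (by norm_num) het0.le
    linarith only [h4, e1, e2, e3, e4, e5]
  have hn0 : 0.999 ≤ n0 := by linarith only [h6, hb2, het2, het0]
  have hn1' : 0.1046 * κ ≤ n1 := by
    have hm0 : 0 ≤ m := le_trans (by positivity) hm
    have e1 : 0.0996 * et * κ * 0.999 ≤ m * n0 := mul_le_mul hm hn0 (by norm_num) hm0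
    have e2 : p * n1 ≤ 0.951 * et * n1 := mul_le_mul_of_nonneg_right hp hn1
    have e3 : 0.0996 * 0.999 * κ * et ≤ 0.951 * n1 * et := by linarith only [e1, e2, h5]
    have e4 := le_of_mul_le_mul_right e3 het0
    linarith only [e4, hκ0]
  have hd1 : 0.1046 / 10 ^ 42 ≤ n1 * τ := by
    have e1 : 0.1046 * κ * τ ≤ n1 * τ := mul_le_mul_of_nonneg_right hn1' hτ0
    have e2 : 0.1046 * (1 / 10 ^ 21) * (1 / 10 ^ 21) ≤ 0.1046 * κ * τ :=
      mul_le_mul (by linarith only [hκ]) hτ (by norm_num) (by positivity)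
    linarith only [e1, e2]
  have hnt2 : nt ≤ 2.87 / 10 ^ 20 / 10 ^ 40 := le_trans hnt (div_le_div_of_nonneg_right hA4 (by positivity))
  linarith only [h7, hd1, hnt2, hd, hetsq, het2]


variable {H : Type*} [NormedAddCommGroup H] [InnerProductSpace ℂ H]

/-- The component of `w` orthogonal to `y` is orthogonal to `y`. [folklore] -/
lemma proj_orth (y w : H) (hY : ((‖y‖ ^ 2 : ℝ) : ℂ) ≠ 0) :
    ⟪w - (⟪y, w⟫_ℂ / ((‖y‖ ^ 2 : ℝ) : ℂ)) • y, y⟫_ℂ = 0 := by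
  rw [inner_sub_left, inner_smul_left, map_div₀, inner_conj_symm, Complex.conj_ofReal, inner_self_eq_coe_norm_sq,
    div_mul_cancel₀ _ hY, sub_self]

/-- `⟪u, w⟫ = ‖u‖²` for `u` = the component of `w` orthogonal to `y`. [folklore] -/
lemma proj_self (y w : H) (hY : ((‖y‖ ^ 2 : ℝ) : ℂ) ≠ 0) :
    ⟪w - (⟪y, w⟫_ℂ / ((‖y‖ ^ 2 : ℝ) : ℂ)) • y, w⟫_ℂ
      = ((‖w - (⟪y, w⟫_ℂ / ((‖y‖ ^ 2 : ℝ) : ℂ)) • y‖ ^ 2 : ℝ) : ℂ) := by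
  have h0 := proj_orth y w hY
  have key : ∀ u : H, ⟪u, y⟫_ℂ = 0 →
      ⟪u, u + (⟪y, w⟫_ℂ / ((‖y‖ ^ 2 : ℝ) : ℂ)) • y⟫_ℂ = ((‖u‖ ^ 2 : ℝ) : ℂ) := by
    intro u hu
    rw [inner_add_right, inner_smul_right, hu, mul_zero, add_zero, inner_self_eq_coe_norm_sq]
  have := key _ h0
  rwa [sub_add_cancel] at this

/-- Four-term triangle inequality `‖a + b − c − d‖ ≤ ‖a‖ + ‖b‖ + ‖c‖ + ‖d‖` in `ℂ`. [folklore] -/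
lemma norm_add_sub_sub_le (a b c d : ℂ) : ‖a + b - c - d‖ ≤ ‖a‖ + ‖b‖ + ‖c‖ + ‖d‖ := by
  have h1 := norm_sub_le (a + b - c) d
  have h2 := norm_sub_le (a + b) c
  have h3 := norm_add_le a b
  linarith

/-- Four-term triangle inequality `‖a − b + c + d‖ ≤ ‖a‖ + ‖b‖ + ‖c‖ + ‖d‖` in `ℂ`. [folklore] -/
lemma norm_sub_add_add_le (a b c d : ℂ) : ‖a - b + c + d‖ ≤ ‖a‖ + ‖b‖ + ‖c‖ + ‖d‖ := by
  have h1 := norm_add_le (a - b + c) d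
  have h2 := norm_add_le (a - b) c
  have h3 := norm_sub_le a b
  linarith

set_option maxHeartbeats 400000 in
/-- **(27) is false in the window.**  Data: `x₀` (‖x₀‖ = 1), `y` (the εθ-minimal vector: `⟪x₀ − y, y⟫ = εθ`),
`w = Ty`, `t = Σ_{j≥2} a_j T^j y` (the tail of ℓ'(T)y), coefficients `a₀ a₁`, tail budget `A`, Lagrange scalar `C`.
Conclusion: the move `‖ℓ'(T)y − (1+δ)y‖` is at least `(εθ)²`, contradicting (27). [cite: Enflo2023, v2 p.13, eq. (27)] -/
theorem eq27_false_in_window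
    (x₀ y w t : H) (a₀ a₁ C : ℂ) (A et : ℝ)
    (h0 : ‖x₀‖ = 1)
    (hey : ⟪x₀ - y, y⟫_ℂ = (et : ℂ))
    (het1 : 1 / 10 ^ 35 ≤ et) (het2 : et ≤ 1 / 10 ^ 23)
    (hρ1 : 0.3 ≤ ‖x₀ - y‖) (hρ2 : ‖x₀ - y‖ ≤ 0.7)
    (hw : ‖w‖ ≤ 1 / 10 ^ 20)
    (hcase : ‖⟪x₀ - y, w⟫_ℂ‖ ≤ et ^ 4)
    (hκ : 1 / 10 ^ 21 ≤ ‖⟪y, w⟫_ℂ‖)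
    (hτ : 1 / 10 ^ 21 ≤ ‖w - (⟪y, w⟫_ℂ / ((‖y‖ ^ 2 : ℝ) : ℂ)) • y‖)
    (hn1A : ‖a₁‖ ≤ A)
    (hbudget : ‖a₀‖ ^ 2 + A ^ 2 ≤ (1 + et / 10) ^ 2)
    (ht : ‖t‖ ≤ A / 10 ^ 40)
    (hk0 : ⟪y, x₀ - (a₀ • y + a₁ • w + t)⟫_ℂ = C * a₀)
    (hk1 : ⟪w, x₀ - (a₀ • y + a₁ • w + t)⟫_ℂ = C * a₁) :
    et ^ 2 ≤ ‖(a₀ • y + a₁ • w + t) - ((1 + et / 10 : ℝ) : ℂ) • y‖ := by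
  by_contra hlt
  push Not at hlt
  have het0 : 0 < et := lt_of_lt_of_le (by norm_num) het1
  -- β := (1+δ) − a₀
  obtain ⟨β, hβ⟩ : ∃ β : ℂ, β = ((1 + et / 10 : ℝ) : ℂ) - a₀ := ⟨_, rfl⟩
  have ha0 : a₀ = ((1 + et / 10 : ℝ) : ℂ) - β := by rw [hβ]; ring
  have hyy : ⟪y, y⟫_ℂ = ((‖y‖ ^ 2 : ℝ) : ℂ) := inner_self_eq_coe_norm_sq y
  have hww : ⟪w, w⟫_ℂ = ((‖w‖ ^ 2 : ℝ) : ℂ) := inner_self_eq_coe_norm_sq w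
  -- ⟪x₀, y⟫ = ⟪y, x₀⟫ = εθ + ‖y‖²
  have hx0y : ⟪x₀, y⟫_ℂ = ((et + ‖y‖ ^ 2 : ℝ) : ℂ) := by
    have h := hey
    rw [inner_sub_left, hyy] at h
    push_cast at h ⊢
    linear_combination h
  have hyx0 : ⟪y, x₀⟫_ℂ = ((et + ‖y‖ ^ 2 : ℝ) : ℂ) := by
    rw [← inner_conj_symm, hx0y, Complex.conj_ofReal]
  -- ‖y‖² = 1 − 2εθ − ‖x₀ − y‖²  ∈ [1/2, 0.91]
  have hYeq : ‖y‖ ^ 2 = 1 - 2 * et - ‖x₀ - y‖ ^ 2 := by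
    have h := norm_sub_sq (𝕜 := ℂ) x₀ y
    rw [hx0y, h0] at h
    simp only [RCLike.re_to_complex, Complex.ofReal_re, one_pow] at h
    linarith
  have hY1 : 1 / 2 ≤ ‖y‖ ^ 2 := by
    have := pow_le_pow_left₀ (norm_nonneg _) hρ2 2
    rw [hYeq]; linarith
  have hY2 : ‖y‖ ^ 2 ≤ 0.91 := by
    have := pow_le_pow_left₀ (by norm_num) hρ1 2
    rw [hYeq]; linarith
  have hYC : ((‖y‖ ^ 2 : ℝ) : ℂ) ≠ 0 := by
    have : (0:ℝ) < ‖y‖ ^ 2 := by linarith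
    exact_mod_cast this.ne'
  -- (h1) the norm budget gives A² ≤ 2(1+δ)|β|
  have hn0sq : ‖a₀‖ ^ 2 = (1 + et / 10 - β.re) ^ 2 + β.im ^ 2 := by
    rw [ha0, ← Complex.normSq_eq_norm_sq, Complex.normSq_apply]
    simp only [Complex.sub_re, Complex.sub_im, Complex.ofReal_re, Complex.ofReal_im]
    ring
  have hbsq : ‖β‖ ^ 2 = β.re ^ 2 + β.im ^ 2 := by
    rw [← Complex.normSq_eq_norm_sq, Complex.normSq_apply]; ring
  have h1 : A ^ 2 ≤ 2 * (1 + et / 10) * ‖β‖ := by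
    have e := mul_le_mul_of_nonneg_left (Complex.re_le_norm β) (by positivity : (0:ℝ) ≤ 1 + et / 10)
    nlinarith [hbudget, hn0sq, e, sq_nonneg β.im, sq_nonneg β.re]
  -- the move D = ℓ'(T)y − (1+δ)y = a₁•w + t − β•y
  have hDeq : (a₀ • y + a₁ • w + t) - ((1 + et / 10 : ℝ) : ℂ) • y = (a₁ • w + t) - β • y := by
    rw [hβ, sub_smul]; abel
  rw [hDeq] at hlt
  -- (h2) |β|‖y‖ ≤ ‖D‖ + |a₁|‖w‖ + ‖t‖
  have h2 : ‖β‖ * ‖y‖ ≤ ‖(a₁ • w + t) - β • y‖ + ‖a₁‖ * ‖w‖ + ‖t‖ := by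
    have e : β • y = (a₁ • w + t) - ((a₁ • w + t) - β • y) := by abel
    have e1 : ‖β • y‖ ≤ ‖a₁ • w + t‖ + ‖(a₁ • w + t) - β • y‖ := by
      rw [e]; exact (norm_sub_le _ _).trans (by rw [← e])
    have e2 := norm_add_le (a₁ • w) t
    rw [norm_smul] at e1 e2
    linarith
  -- (h3) |⟨y, R⟩| ≤ εθ(1 − ‖y‖²/10) + |β|‖y‖² + |a₁|κ₁ + ‖y‖‖t‖
  have hyR : ⟪y, x₀ - (a₀ • y + a₁ • w + t)⟫_ℂ
      = ((et - et / 10 * ‖y‖ ^ 2 : ℝ) : ℂ) + β * ((‖y‖ ^ 2 : ℝ) : ℂ) - a₁ * ⟪y, w⟫_ℂ - ⟪y, t⟫_ℂ := by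
    rw [inner_sub_right, inner_add_right, inner_add_right, inner_smul_right, inner_smul_right, hyy, hyx0, ha0]
    push_cast; ring
  have h3 : ‖⟪y, x₀ - (a₀ • y + a₁ • w + t)⟫_ℂ‖
      ≤ et * (1 - ‖y‖ ^ 2 / 10) + ‖β‖ * ‖y‖ ^ 2 + ‖a₁‖ * ‖⟪y, w⟫_ℂ‖ + ‖y‖ * ‖t‖ := by
    rw [hyR]
    have epos : 0 ≤ et - et / 10 * ‖y‖ ^ 2 := by
      have := mul_le_mul_of_nonneg_left hY2 het0.le
      linarith
    have e0 := norm_add_sub_sub_le (((et - et / 10 * ‖y‖ ^ 2 : ℝ)) : ℂ) (β * ((‖y‖ ^ 2 : ℝ) : ℂ))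
      (a₁ * ⟪y, w⟫_ℂ) ⟪y, t⟫_ℂ
    have e1 : ‖(((et - et / 10 * ‖y‖ ^ 2 : ℝ)) : ℂ)‖ = et - et / 10 * ‖y‖ ^ 2 := by
      rw [Complex.norm_real, Real.norm_of_nonneg epos]
    have e2 : ‖β * ((‖y‖ ^ 2 : ℝ) : ℂ)‖ = ‖β‖ * ‖y‖ ^ 2 := by
      rw [norm_mul, Complex.norm_real, Real.norm_of_nonneg (by positivity)]
    have e3 : ‖a₁ * ⟪y, w⟫_ℂ‖ = ‖a₁‖ * ‖⟪y, w⟫_ℂ‖ := norm_mul _ _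
    have e4 : ‖⟪y, t⟫_ℂ‖ ≤ ‖y‖ * ‖t‖ := norm_inner_le_norm (𝕜 := ℂ) y t
    have e5 : et * (1 - ‖y‖ ^ 2 / 10) = et - et / 10 * ‖y‖ ^ 2 := by ring
    linarith [e0, e1, e2, e3, e4, e5]
  -- (h4) |⟨Ty, R⟩| ≥ (δ − |β|)κ₁ − εθ⁴ − |a₁|‖w‖² − ‖w‖‖t‖
  have hwR : ⟪w, x₀ - (a₀ • y + a₁ • w + t)⟫_ℂ
      = ⟪w, x₀ - y⟫_ℂ + (β - ((et / 10 : ℝ) : ℂ)) * ⟪w, y⟫_ℂ - a₁ * ((‖w‖ ^ 2 : ℝ) : ℂ) - ⟪w, t⟫_ℂ := by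
    rw [inner_sub_right, inner_add_right, inner_add_right, inner_smul_right, inner_smul_right, hww,
      inner_sub_right, ha0]
    push_cast; ring
  have h4 : (et / 10 - ‖β‖) * ‖⟪y, w⟫_ℂ‖ - et ^ 4 - ‖a₁‖ * ‖w‖ ^ 2 - ‖w‖ * ‖t‖
      ≤ ‖⟪w, x₀ - (a₀ • y + a₁ • w + t)⟫_ℂ‖ := by
    have e : (β - ((et / 10 : ℝ) : ℂ)) * ⟪w, y⟫_ℂ
        = ⟪w, x₀ - (a₀ • y + a₁ • w + t)⟫_ℂ - ⟪w, x₀ - y⟫_ℂ + a₁ * ((‖w‖ ^ 2 : ℝ) : ℂ) + ⟪w, t⟫_ℂ := by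
      rw [hwR]; ring
    have n1 : ‖(β - ((et / 10 : ℝ) : ℂ)) * ⟪w, y⟫_ℂ‖ ≤ ‖⟪w, x₀ - (a₀ • y + a₁ • w + t)⟫_ℂ‖
        + ‖⟪w, x₀ - y⟫_ℂ‖ + ‖a₁ * ((‖w‖ ^ 2 : ℝ) : ℂ)‖ + ‖⟪w, t⟫_ℂ‖ := by
      rw [e]; exact norm_sub_add_add_le _ _ _ _
    have n2 : ‖(β - ((et / 10 : ℝ) : ℂ)) * ⟪w, y⟫_ℂ‖ = ‖β - ((et / 10 : ℝ) : ℂ)‖ * ‖⟪y, w⟫_ℂ‖ := by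
      rw [norm_mul, norm_inner_symm]
    have n3 : et / 10 - ‖β‖ ≤ ‖β - ((et / 10 : ℝ) : ℂ)‖ := by
      have := norm_sub_norm_le (((et / 10 : ℝ)) : ℂ) β
      rw [Complex.norm_real, Real.norm_of_nonneg (by positivity), norm_sub_rev] at this
      exact this
    have n4 : ‖⟪w, x₀ - y⟫_ℂ‖ ≤ et ^ 4 := by rw [norm_inner_symm]; exact hcase
    have n5 : ‖a₁ * ((‖w‖ ^ 2 : ℝ) : ℂ)‖ = ‖a₁‖ * ‖w‖ ^ 2 := by
      rw [norm_mul, Complex.norm_real, Real.norm_of_nonneg (by positivity)]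
    have n6 : ‖⟪w, t⟫_ℂ‖ ≤ ‖w‖ * ‖t‖ := norm_inner_le_norm (𝕜 := ℂ) w t
    have n7 : (et / 10 - ‖β‖) * ‖⟪y, w⟫_ℂ‖ ≤ ‖β - ((et / 10 : ℝ) : ℂ)‖ * ‖⟪y, w⟫_ℂ‖ :=
      mul_le_mul_of_nonneg_right n3 (norm_nonneg _)
    linarith [n1, n2, n4, n5, n6, n7]
  -- (h5) the two Lagrange coordinates: |⟨Ty,R⟩|·|a₀| = |⟨y,R⟩|·|a₁|
  have h5 : ‖⟪w, x₀ - (a₀ • y + a₁ • w + t)⟫_ℂ‖ * ‖a₀‖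
      = ‖⟪y, x₀ - (a₀ • y + a₁ • w + t)⟫_ℂ‖ * ‖a₁‖ := by
    have e : ⟪w, x₀ - (a₀ • y + a₁ • w + t)⟫_ℂ * a₀ = ⟪y, x₀ - (a₀ • y + a₁ • w + t)⟫_ℂ * a₁ := by
      rw [hk0, hk1]; ring
    have := congrArg (fun z : ℂ => ‖z‖) e
    simpa only [norm_mul] using this
  -- (h6) |a₀| ≥ 1 + δ − |β|
  have h6 : 1 + et / 10 - ‖β‖ ≤ ‖a₀‖ := by
    have := norm_sub_norm_le (((1 + et / 10 : ℝ)) : ℂ) β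
    rw [Complex.norm_real, Real.norm_of_nonneg (by positivity), ← ha0] at this
    exact this
  -- (h7) projecting on (ℂy)^⊥ :  |a₁| τ₁ − ‖t‖ ≤ ‖D‖
  have h7 : ‖a₁‖ * ‖w - (⟪y, w⟫_ℂ / ((‖y‖ ^ 2 : ℝ) : ℂ)) • y‖ - ‖t‖ ≤ ‖(a₁ • w + t) - β • y‖ := by
    have ho := proj_orth y w hYC
    have hs := proj_self y w hYC
    have hiD : ⟪w - (⟪y, w⟫_ℂ / ((‖y‖ ^ 2 : ℝ) : ℂ)) • y, (a₁ • w + t) - β • y⟫_ℂ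
        = a₁ * ((‖w - (⟪y, w⟫_ℂ / ((‖y‖ ^ 2 : ℝ) : ℂ)) • y‖ ^ 2 : ℝ) : ℂ)
          + ⟪w - (⟪y, w⟫_ℂ / ((‖y‖ ^ 2 : ℝ) : ℂ)) • y, t⟫_ℂ := by
      rw [inner_sub_right, inner_add_right, inner_smul_right, inner_smul_right, hs, ho, mul_zero, sub_zero]
    have hCS := norm_inner_le_norm (𝕜 := ℂ) (w - (⟪y, w⟫_ℂ / ((‖y‖ ^ 2 : ℝ) : ℂ)) • y) ((a₁ • w + t) - β • y)
    rw [hiD] at hCS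
    have e1 := norm_sub_le
      (a₁ * ((‖w - (⟪y, w⟫_ℂ / ((‖y‖ ^ 2 : ℝ) : ℂ)) • y‖ ^ 2 : ℝ) : ℂ)
        + ⟪w - (⟪y, w⟫_ℂ / ((‖y‖ ^ 2 : ℝ) : ℂ)) • y, t⟫_ℂ)
      ⟪w - (⟪y, w⟫_ℂ / ((‖y‖ ^ 2 : ℝ) : ℂ)) • y, t⟫_ℂ
    rw [add_sub_cancel_right, norm_mul, Complex.norm_real, Real.norm_of_nonneg (by positivity)] at e1
    have e2 := norm_inner_le_norm (𝕜 := ℂ) (w - (⟪y, w⟫_ℂ / ((‖y‖ ^ 2 : ℝ) : ℂ)) • y) t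
    have hτ0 : 0 < ‖w - (⟪y, w⟫_ℂ / ((‖y‖ ^ 2 : ℝ) : ℂ)) • y‖ := lt_of_lt_of_le (by norm_num) hτ
    have e3 : (‖a₁‖ * ‖w - (⟪y, w⟫_ℂ / ((‖y‖ ^ 2 : ℝ) : ℂ)) • y‖ - ‖t‖)
        * ‖w - (⟪y, w⟫_ℂ / ((‖y‖ ^ 2 : ℝ) : ℂ)) • y‖
        ≤ ‖(a₁ • w + t) - β • y‖ * ‖w - (⟪y, w⟫_ℂ / ((‖y‖ ^ 2 : ℝ) : ℂ)) • y‖ := by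
      nlinarith [hCS, e1, e2, hτ0.le, norm_nonneg t, norm_nonneg a₁]
    exact le_of_mul_le_mul_right e3 hτ0
  -- the scalar core closes the argument
  exact scalar_core et (‖y‖ ^ 2) ‖y‖ ‖β‖ A ‖a₁‖ ‖w‖ ‖⟪y, w⟫_ℂ‖
    ‖w - (⟪y, w⟫_ℂ / ((‖y‖ ^ 2 : ℝ) : ℂ)) • y‖ ‖t‖
    ‖⟪y, x₀ - (a₀ • y + a₁ • w + t)⟫_ℂ‖ ‖⟪w, x₀ - (a₀ • y + a₁ • w + t)⟫_ℂ‖ ‖a₀‖ ‖(a₁ • w + t) - β • y‖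
    het1 het2 hY1 hY2 (norm_nonneg _) rfl (norm_nonneg _) (norm_nonneg _) hn1A h1 (norm_nonneg _) hw hκ
    (norm_inner_le_norm (𝕜 := ℂ) y w) hτ (norm_nonneg _) ht h2 h3 h4 h5 h6 h7 hlt

end CaseII

end Literature.Analysis.OperatorTheory.Enflo2023

end
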